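import Summits.QuantumFields.YangMills.Theorems.LuscherReductionDressedRitzPolyakovLiftTransplantRoot
import Literature.Analysis.OperatorTheory.YangMillsMatrixModelGroundStateSign
import HarnessLib

/-!
# Route `LuscherReduction`, item `DressedRitz` (stmt-QuantumFields-20205), line «polyakovlift» — SKELETON r7: the basis predicate `TransplantBasisLR`
# (radius floor re-pinned at `R ≥ Λ^{−1/4}`) (LEAD prover ym-lead-20205-polyakovlift g2)

WHY r7.  The one-site shadow trial vector of the line is `x_i = (g_i∘p_L)·e_0 = (Ψ_{i+1} − (g_i∘p_L)·η)/a`, `η = Φ̂₀ − a e_0` the defect of the explicit vacuum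
quasimode against the TRUE one-site vacuum `e_0`, of which only global spectral data are available; the contamination is therefore controlled only as
`‖(g_i∘p_L)η‖ ≤ C_f·‖η‖`, `C_f(R) = sup_{‖y‖≤√2R} |f_{i+1}|/f_0`, while `‖η‖/a` has an `L`-independent floor `≍ e^{−cR_v}`, `R_v < π/(√2Λ)` (injectivity
radius of `U ↦ U^L` in the chart).  With r6's floor `R ≥ 1/(8Λ)` this asks for valley-Agmon RATIO asymptotics of the eigenfunctions of `𝔥` (not in print);
with the floor `R ≥ Λ^{−1/4}` of THIS file it asks only for a pointwise ground-state lower bound `f_0(y) ≥ c·e^{−a‖y‖⁴}` with `4a < 1`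
(the published cubic bound of Carmona–Simon ∕ Davies–Simon (6.4) gives every `a`; an elementary annulus-comparison proof is being typed as a Literature
THEOREM by seat infvol-p2, so r7 registers NO named-fact stub), since then `C_f(Λ^{−1/4}) ≤ (C/c)·e^{4a/Λ} ≪ Λ²e^{1.1/Λ}`.  The floor still excludes
`R = O(1)` (cdisprove pre-vet V1: the ∀-basis RG stubs must not see cut-offs with `Λ`-independent level admixture; here the admixture is
`poly(1/Λ)·e^{−Λ^{−1/4}}`; honest size (cdisprove R7-PREVET): `Λ^{−1/4} ≥ 2 log(1/Λ)` first holds near `Λ ≈ 2·10⁻⁶`, so `lam0` is tiny).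

* ★ `TransplantBasisLR k L Λ g` — `g_i = transplantObsL L Λ R f i` for an AL1 eigenfamily `f` with `f_0 > 0` and a radius with `1 ≤ R`, `1 ≤ R⁴Λ`, `RΛ ≤ 1/4`;
* `basisPhysL_transplantBasisLR` — members are physical; `transplantBasisLR_nonempty_of_radius`, ★ `transplantBasisLR_nonempty`
  (`0 < Λ ≤ 1/8`, witness radius `R = Λ^{−1/4} = √√(1/Λ)`).

HONEST FRAMING: a definition and its bookkeeping on the conditional femto rung R2b1; nothing here bears on infinite volume, the continuum limit or the Clay gap.
References: R. Carmona, B. Simon, CMP 80 (1981) 59 [cite: CarmonaSimon1981]; E. B. Davies, B. Simon, JFA 59 (1984) 335 [cite: DaviesSimon1984, §6];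
M. Lüscher, NPB 219 (1983) 233 [cite: Luscher1983, §2–§3]; Reed–Simon IV [cite: ReedSimonIV1978, Thm. XIII.47–48].
-/

set_option autoImplicit false

noncomputable section

open MeasureTheory Filter Topology Real
open Literature.MathematicalPhysics.QuantumFieldTheory (GaugeConfig Site gaugeTransform)
open Literature.Analysis.OperatorTheory.YMMatrixModel
open scoped BigOperators Matrix

namespace Summit.QuantumFields.YangMills.Theorems.FemtoTransferGap.PolyakovLift

open Summit.QuantumFields.YangMills.Theorems.FemtoTransferGap

/-! ## §1 The r7 basis predicate -/

/-- ★ **The r7 basis predicate `TransplantBasisLR k L Λ g`**: `g_i = transplantObsL L Λ R f i` (`= (χ_R f_{i+1}/f_0) ∘ rootCoord L (Λ/2)`) for an AL1 eigenfamily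
`f_0, …, f_k` of `𝔥` with `f_0 > 0` and a cut-off radius with `1 ≤ R`, `Λ^{−1/4} ≤ R` (as `1 ≤ R⁴Λ`) and `RΛ ≤ 1/4`. [cite: Luscher1983, §2–§3]
[cite: ReedSimonIV1978, Thm. XIII.64] -/
def TransplantBasisLR (k : ℕ) (L : ℕ) (Λ : ℝ) (g : Fin k → (Cfg → ℝ)) : Prop :=
  ∃ (f : Fin (k + 1) → ZM → ℝ) (R : ℝ), IsEigenFamily k f ∧ (∀ x, 0 < f 0 x) ∧ 1 ≤ R ∧ 1 ≤ R ^ 4 * Λ ∧ R * Λ ≤ 1 / 4 ∧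
    ∀ i : Fin k, g i = transplantObsL L Λ R f i

/-- Members of an r7 transplant basis are physical (the hypothesis `BasisPhysL TransplantBasisLR` of the composition). [cite: Luscher1983, §3] -/
theorem basisPhysL_transplantBasisLR (k : ℕ) :
    ∀ (L : ℕ) (Λ : ℝ) (g : Fin k → (Cfg → ℝ)), TransplantBasisLR k L Λ g → ∀ i, IsPhys (g i) := by
  intro L Λ g hg i
  obtain ⟨f, R, hf, hpos, hR1, -, -, hgi⟩ := hg
  obtain ⟨hm, hb, hinv⟩ := transplantFn_props (lt_of_lt_of_le one_pos hR1) hf hpos i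
  rw [hgi i]
  exact isPhys_rootPullback hm hb hinv L (Λ / 2)

/-! ## §2 Nonvacuity -/

/-- An r7 transplant basis at a prescribed admissible radius. [cite: ReedSimonIV1978, Thm. XIII.47–48] [cite: Luscher1983, §2–§3] -/
theorem transplantBasisLR_nonempty_of_radius (k L : ℕ) {Λ R : ℝ} (hR : 1 ≤ R) (hlo : 1 ≤ R ^ 4 * Λ) (hhi : R * Λ ≤ 1 / 4) :
    ∃ g : Fin k → (Cfg → ℝ), TransplantBasisLR k L Λ g ∧
      ∃ f : Fin (k + 1) → ZM → ℝ, IsEigenFamily k f ∧ (∀ x, 0 < f 0 x) ∧ ∀ i, g i = transplantObsL L Λ R f i := by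
  obtain ⟨f, h1, h2, h3, h4, h5, hpos⟩ := exists_eigenfunctions_pos_groundState k
  exact ⟨fun i => transplantObsL L Λ R f i, ⟨f, R, ⟨h1, h2, h3, h4, h5⟩, hpos, hR, hlo, hhi, fun _ => rfl⟩,
    f, ⟨h1, h2, h3, h4, h5⟩, hpos, fun _ => rfl⟩

/-- ★ **The r7 basis predicate is nonvacuous** for `0 < Λ ≤ 1/8` and every `L` (witness radius `R = √√(1/Λ) = Λ^{−1/4}`: `R⁴Λ = 1`, `(RΛ)⁴ = Λ³ ≤ 1/512 < (1/4)⁴`).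
[cite: ReedSimonIV1978, Thm. XIII.47–48] [cite: Luscher1983, §2–§3] -/
theorem transplantBasisLR_nonempty (k L : ℕ) {Λ : ℝ} (hΛ : 0 < Λ) (hΛ8 : Λ ≤ 1 / 8) :
    ∃ g : Fin k → (Cfg → ℝ), TransplantBasisLR k L Λ g := by
  set R := Real.sqrt (Real.sqrt (1 / Λ)) with hRdef
  have hR0 : 0 ≤ R := Real.sqrt_nonneg _
  have hR4 : R ^ 4 = 1 / Λ := by
    rw [hRdef, show (4 : ℕ) = 2 * 2 from rfl, pow_mul, Real.sq_sqrt (Real.sqrt_nonneg _), Real.sq_sqrt (by positivity)]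
  have hR4Λ : R ^ 4 * Λ = 1 := by rw [hR4]; field_simp
  have hR1 : 1 ≤ R := by
    by_contra h
    push Not at h
    have : R ^ 4 < 1 := by
      calc R ^ 4 < 1 ^ 4 := pow_lt_pow_left₀ h hR0 (by norm_num)
        _ = 1 := one_pow 4
    have h8 : (1 : ℝ) ≤ 1 / Λ := by rw [le_div_iff₀ hΛ]; linarith
    linarith [hR4]
  have hhi : R * Λ ≤ 1 / 4 := by
    have hx0 : 0 ≤ R * Λ := mul_nonneg hR0 hΛ.le
    have hx4 : (R * Λ) ^ 4 ≤ (1 / 4 : ℝ) ^ 4 := by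
      have e : (R * Λ) ^ 4 = Λ ^ 3 := by rw [mul_pow, hR4]; field_simp
      rw [e]
      calc Λ ^ 3 ≤ (1 / 8 : ℝ) ^ 3 := pow_le_pow_left₀ hΛ.le hΛ8 3
        _ ≤ (1 / 4 : ℝ) ^ 4 := by norm_num
    exact le_of_pow_le_pow_left₀ (by norm_num) (by norm_num) hx4
  obtain ⟨g, hg, -⟩ := transplantBasisLR_nonempty_of_radius k L hR1 (le_of_eq hR4Λ.symm) hhi
  exact ⟨g, hg⟩

end Summit.QuantumFields.YangMills.Theorems.FemtoTransferGap.PolyakovLift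

end
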